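import Literature.MathematicalPhysics.KineticTheory.CollisionFluxMeanBoundNonStationary
import Summits.AtomisticToContinuum.HydrodynamicLimit.Theorems.AnnealedZeroHorizonMeanFluxClosureCollisionEnergyExchangeMeanBound
import Summits.AtomisticToContinuum.HydrodynamicLimit.Theorems.InformationPercolationEngineCollisionRateCollisionMarkFluxLGOfEnvelope
import Summits.AtomisticToContinuum.HydrodynamicLimit.Theorems.InformationPercolationEngineCollisionRateMarginalEnvelopeOfLanfordEnvelope
import HarnessLib

/-!
# Stub FLUX `stub_collisionEnergyExchangeMeanBound` of crux `MeanFluxClosure`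
# (stmt-AtomisticToContinuum-9256, route AnnealedZeroHorizon, line `registered`) — part B: the stub's functional
# verbatim; the general case REDUCED to the crux item `BGEndpointRigidity.LanfordEnvelopeR`

Sequel of `…CollisionEnergyExchangeMeanBound.lean` (part A: measurability, pathwise domination, constant-profile mean
bounds, general-profile integrability of the windowed absolute energy-jump functional `𝒮ᴱ` and of the relative-speed
functional). Here, with `Q = σ_N (N+1)⁻¹ 𝒮ᴱ(Φ_{t₁} z; (0, t₂ − t₁])` the stub's functional VERBATIM:

* `collisionEnergyExchange_const`, `stub_collisionEnergyExchangeMeanBound_const` — the registered stub HOLDS at constant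
  profiles (`σ₀ = 1/2`, `C = 160 σ³ (1 + 8(‖u‖⁴ + 15θ²)) (t₂ − t₁)`, every `N`);
* `integrable_collisionEnergyExchange` — for general continuous profiles the INTEGRABILITY half holds at every `N`;
* `integral_flow_le_of_windowFluxBound` (generic kernel / mark, any law carried by the good set) and
  `integral_absEnergyJumpFunctional_flow_le_of_energyFluxBound` — at each `N` the MEAN half follows from a bound on the mean
  energy-weighted contact flux of the NON-stationary local Gibbs law over the collision times in `[t₁, t₂]`,
  `(ε_N/(N+1)) E_{LG_N}[Σᶠ_{r ∈ [t₁,t₂]} Σᵢ Σ_k 𝟙{contact} ‖vᵢ − v_k‖ (‖vᵢ‖ + ‖v_k‖)(Φ_r z)] ≤ C` (the window is moved between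
  the orbits of `z` and `Φ_{t₁} z` by `finsum_collisionTimes_shift`) — hypothesis (i) of
  `mmr_energy_of_collisionFlux_of_cubicMoment`, uniform in `N` the one missing input;
* `lintegral_windowCollisionSum_le_of_pairEnvelope` — that window flux bound, for any velocity mark, from a PAIR ENVELOPE of the
  law at the times of the window (mean form, general window, of `CollisionRate.stub_collisionMarkFluxLG_of_envelope`: the
  non-stationary one-window / Campbell inequality `lintegral_le_liminf_mul_of_le_collisionSum`, Cercignani–Illner–Pulvirenti
  1994 App. 4.A, swept tubes, one-window statics `lintegral_pairTubeSet_indicator_le`); with `(N+1) ε_N³ = σ³` it is uniform in `N`;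
* `stub_of_marginalEnvelope`, `stub_collisionEnergyExchangeMeanBound_of_lanfordEnvelopeR` — hence the registered stub, VERBATIM,
  follows from the marginal envelope (A) of crux `CollisionRate`, hence from the crux item
  `Theses.BGEndpointRigidity.LanfordEnvelopeR` (stmt-13677; `CollisionRate.stub_marginalEnvelopeLG_of_lanfordEnvelopeR`) — the
  Lanford/BGSR Gaussian envelope of the marginals of the evolved local Gibbs law, open at positive times at fixed reduced
  density. (The two cheaper tools fail uniformly in `N`: the domination `LG_N ≤ Λ^{N+1} G_N` of part A costs `Λ^{N+1}`; the
  entropy inequality with `H(LG_N | G_N) = O(N)` needs the window large-deviation bound `log E_{G_N} exp(ε_N 𝒮ᴹ) = O(N)`.)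

References: C. Cercignani, R. Illner, M. Pulvirenti, *The Mathematical Theory of Dilute Gases* (1994) App. 4.A;
I. Gallagher, L. Saint-Raymond, B. Texier, *From Newton to Boltzmann* (2013) Ch. 4–6; H. Spohn, *Large Scale Dynamics of
Interacting Particles* (1991) Part I §2.3.
-/

noncomputable section

namespace Summit.AtomisticToContinuum.HydrodynamicLimit.Theorems

open scoped BigOperators ENNReal Topology InnerProductSpace
open MeasureTheory Set Filter
open Literature.MathematicalPhysics.KineticTheory Literature.Analysis.FluidPDE Literature.Analysis.FunctionSpaces
open Summit.AtomisticToContinuum.HydrodynamicLimit.Theorems.RestartPrinciple.AgeDuhamelForgetting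

namespace CollisionEnergyExchangeMeanBound

/-! ## The stub's functional `Q` verbatim: constant profiles (A), general profiles (B) -/

/-- **Deliverable (A), verbatim form.** For constant profiles `a, θ > 0`, `u`, every `0 < σ ≤ 1/2`, every flow
family, all `0 ≤ t₁ ≤ t₂` and EVERY `N`: the stub's functional `Q = σ_N (N+1)⁻¹ 𝒮ᴱ(Φ_{t₁} z; (0, t₂ − t₁])` is
integrable under `G_N = localGibbsLaw σ a u θ N (Φ N)` with `E Q ≤ 160 σ³ (1 + 8(‖u‖⁴ + 15 θ²)) (t₂ − t₁)`. [folklore] -/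
theorem collisionEnergyExchange_const {σ : ℝ} (hσ : 0 < σ) (hσ2 : σ ≤ 1 / 2) {a θ : ℝ} (u : V3) (ha : 0 < a)
    (hθ : 0 < θ) (Φ : (N : ℕ) → HardSphereFlow (Torus.geometry (Fin 3)) (hsDiameter σ N) (N + 1)) {t₁ t₂ : ℝ}
    (h₁ : 0 ≤ t₁) (h₁₂ : t₁ ≤ t₂) (N : ℕ) :
    ∀ Q : Config (N + 1) (Fin 3) T3 → ℝ, Q = (fun z => hsDiameter σ N * ((N + 1 : ℕ) : ℝ)⁻¹ *
      (Φ N).collisionalTransferFunctional (fun (i _j : Fin (N + 1)) (pre post : Config (N + 1) (Fin 3) T3) =>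
        |‖(post i).2‖ ^ 2 - ‖(pre i).2‖ ^ 2| / 2) ((Φ N).flow t₁ z) (t₂ - t₁)) →
      Integrable Q (localGibbsLaw σ (fun _ => a) (fun _ => u) (fun _ => θ) N (Φ N)) ∧
        ∫ z, Q z ∂(localGibbsLaw σ (fun _ => a) (fun _ => u) (fun _ => θ) N (Φ N)) ≤
          160 * σ ^ 3 * (1 + 8 * (‖u‖ ^ 4 + 15 * θ ^ 2)) * (t₂ - t₁) := by
  intro Q hQ
  obtain ⟨hI, hmean⟩ := absEnergyJumpFunctional_flow_const hσ hσ2 u ha hθ (Φ N) h₁ h₁₂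
  subst hQ
  rw [← integral_const_mul] at hmean
  exact ⟨hI.const_mul _, hmean⟩

/-- **The registered stub HOLDS at constant profiles** (its exact quantifier shape, `a₀ ≡ a`, `θ₀ ≡ θ`, `u₀ ≡ u`;
`σ₀ = 1/2`, `C = 160 σ³ (1 + 8(‖u‖⁴ + 15 θ²)) (t₂ − t₁)`, all `N`). [folklore] -/
theorem stub_collisionEnergyExchangeMeanBound_const (a θ : ℝ) (u : V3) (ha : 0 < a) (hθ : 0 < θ) :
    ∃ σ₀ : ℝ, 0 < σ₀ ∧ ∀ σ : ℝ, 0 < σ → σ < σ₀ →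
      ∀ Φ : (N : ℕ) → HardSphereFlow (Torus.geometry (Fin 3)) (hsDiameter σ N) (N + 1), ∀ t₁ t₂ : ℝ, 0 ≤ t₁ → t₁ ≤ t₂ →
      ∃ C : ℝ, ∀ᶠ N in atTop, ∀ Q : Config (N + 1) (Fin 3) T3 → ℝ, Q = (fun z => hsDiameter σ N * ((N + 1 : ℕ) : ℝ)⁻¹ *
        (Φ N).collisionalTransferFunctional (fun (i _j : Fin (N + 1)) (pre post : Config (N + 1) (Fin 3) T3) =>
          |‖(post i).2‖ ^ 2 - ‖(pre i).2‖ ^ 2| / 2) ((Φ N).flow t₁ z) (t₂ - t₁)) →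
        Integrable Q (localGibbsLaw σ (fun _ => a) (fun _ => u) (fun _ => θ) N (Φ N)) ∧
          ∫ z, Q z ∂(localGibbsLaw σ (fun _ => a) (fun _ => u) (fun _ => θ) N (Φ N)) ≤ C :=
  ⟨1 / 2, by norm_num, fun _σ hσ hσ2 Φ _t₁ _t₂ h₁ h₁₂ =>
    ⟨_, Eventually.of_forall fun N => collisionEnergyExchange_const hσ hσ2.le u ha hθ Φ h₁ h₁₂ N⟩⟩

variable {a₀ θ₀ : T3 → ℝ} {u₀ : T3 → V3}

/-- **Deliverable (B), verbatim form**: for continuous `a₀, θ₀ > 0`, `u₀`, `0 < σ ≤ 1/2`, every flow family,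
`0 ≤ t₁ ≤ t₂` and EVERY `N`, the stub's functional `Q` is integrable under `localGibbsLaw σ a₀ u₀ θ₀ N (Φ N)`. [folklore] -/
theorem integrable_collisionEnergyExchange (ha : Continuous a₀) (hθ : Continuous θ₀) (hu : Continuous u₀)
    (ha0 : ∀ x, 0 < a₀ x) (hθ0 : ∀ x, 0 < θ₀ x) {σ : ℝ} (hσ : 0 < σ) (hσ2 : σ ≤ 1 / 2)
    (Φ : (N : ℕ) → HardSphereFlow (Torus.geometry (Fin 3)) (hsDiameter σ N) (N + 1)) {t₁ t₂ : ℝ} (h₁ : 0 ≤ t₁)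
    (h₁₂ : t₁ ≤ t₂) (N : ℕ) :
    ∀ Q : Config (N + 1) (Fin 3) T3 → ℝ, Q = (fun z => hsDiameter σ N * ((N + 1 : ℕ) : ℝ)⁻¹ *
      (Φ N).collisionalTransferFunctional (fun (i _j : Fin (N + 1)) (pre post : Config (N + 1) (Fin 3) T3) =>
        |‖(post i).2‖ ^ 2 - ‖(pre i).2‖ ^ 2| / 2) ((Φ N).flow t₁ z) (t₂ - t₁)) →
      Integrable Q (localGibbsLaw σ a₀ u₀ θ₀ N (Φ N)) := by
  intro Q hQ
  subst hQ
  exact (integrable_absEnergyJumpFunctional_flow ha hθ hu ha0 hθ0 hσ hσ2 (Φ N) h₁ h₁₂).const_mul _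

/-! ## The general case REDUCED to the mean energy-weighted contact flux of the non-stationary law -/

/-- **Reduction of the mean bound to a window collision-flux bound (general profiles, generic kernel).** For
continuous `a₀, θ₀ > 0`, `u₀`, `0 < σ ≤ 1/2`, a flow `Φ` of `N + 1` spheres, `0 ≤ t₁ ≤ t₂`, a nonnegative kernel
`g` dominated at collisions by a nonnegative mark `M`, IF the mean inline collision sum of `M` over the collision
times of the orbit in `[t₁, t₂]` under the local Gibbs law `P = localGibbsLaw σ a₀ u₀ θ₀ N Φ` satisfies
`(ε_N/(N+1)) E_P[Σᶠ_{r ∈ [t₁,t₂]} Σᵢ Σ_k 𝟙{contact} M(Φ_r z, i, k)] ≤ C`, THEN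
`(ε_N/(N+1)) E_P[W_g(Φ_{t₁} z; (0, t₂ − t₁])] ≤ C` — the window is moved from the orbit of `Φ_{t₁} z` to the
orbit of `z` by the group law (`finsum_collisionTimes_shift`); `P` is carried by the good set. The hypothesis
is the one-window / Campbell bound of Cercignani–Illner–Pulvirenti for the NON-invariant law `P`
(`lintegral_le_liminf_mul_of_le_collisionSum` reduces it to the contact flux of the transported laws `(Φ_r)_* P`).
[folklore] -/
theorem integral_flow_le_of_windowFluxBound {σ : ℝ} (hσ : 0 < σ) {N : ℕ} (hN : 1 ≤ N) (hσ2 : σ ≤ 1 / 2)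
    (Φ : HardSphereFlow (Torus.geometry (Fin 3)) (hsDiameter σ N) (N + 1))
    {g : Fin (N + 1) → Fin (N + 1) → Config (N + 1) (Fin 3) T3 → Config (N + 1) (Fin 3) T3 → ℝ}
    (hg0 : ∀ i j pre post, 0 ≤ g i j pre post)
    {M : Config (N + 1) (Fin 3) T3 → Fin (N + 1) → Fin (N + 1) → ℝ} (hM : ∀ w i k, 0 ≤ M w i k)
    (hgM : ∀ {γ : ℝ → Config (N + 1) (Fin 3) T3},
      IsHardSphereTrajectory (Torus.geometry (Fin 3)) (hsDiameter σ N) (N + 1) γ →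
      ∀ t : ℝ, ∀ p ∈ contactPairs (Torus.geometry (Fin 3)) (hsDiameter σ N) (γ t),
        g p.1 p.2 (Function.leftLim γ t) (γ t) ≤ M (γ t) p.1 p.2)
    (P : Measure (Config (N + 1) (Fin 3) T3)) (hP : P Φ.goodᶜ = 0) {t₁ t₂ : ℝ}
    (hI : Integrable (fun z => Φ.collisionalTransferFunctional g (Φ.flow t₁ z) (t₂ - t₁)) P) {C : ℝ} (hC : 0 ≤ C)
    (hflux : ENNReal.ofReal (hsDiameter σ N / ((N + 1 : ℕ) : ℝ)) *
      ∫⁻ z, (∑ᶠ r ∈ collisionTimes (Torus.geometry (Fin 3)) (hsDiameter σ N) (fun t => Φ.flow t z) ∩ Icc t₁ t₂,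
        ∑ i, ∑ k, (if i ≠ k ∧ ‖(Torus.geometry (Fin 3)).sepVec (Φ.flow r z i).1 (Φ.flow r z k).1‖ = hsDiameter σ N
          then ENNReal.ofReal (M (Φ.flow r z) i k) else 0)) ∂P ≤ ENNReal.ofReal C) :
    hsDiameter σ N * ((N + 1 : ℕ) : ℝ)⁻¹ * ∫ z, Φ.collisionalTransferFunctional g (Φ.flow t₁ z) (t₂ - t₁) ∂P ≤ C := by
  have hε : hsDiameter σ N < 2⁻¹ := (hsDiameter_lt_half_of_one_le hσ2 hN).trans_eq (one_div 2)
  have hεpos : 0 < hsDiameter σ N := hsDiameter_pos hσ N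
  have hae : ∀ᵐ z ∂P, z ∈ Φ.good := by rw [ae_iff]; exact hP
  set F : Config (N + 1) (Fin 3) T3 → ℝ := fun w => Φ.collisionalTransferFunctional g w (t₂ - t₁) with hFdef
  have hF0 : ∀ w, 0 ≤ F w := fun w => collisionalTransferFunctional_nonneg Φ hg0 w _
  set H : Config (N + 1) (Fin 3) T3 → ℝ≥0∞ := fun w => ∑ i, ∑ k,
    (if i ≠ k ∧ ‖(Torus.geometry (Fin 3)).sepVec (w i).1 (w k).1‖ = hsDiameter σ N
      then ENNReal.ofReal (M w i k) else 0) with hHdef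
  have hpath : ∀ᵐ z ∂P, ENNReal.ofReal (F (Φ.flow t₁ z)) ≤
      ∑ᶠ r ∈ collisionTimes (Torus.geometry (Fin 3)) (hsDiameter σ N) (fun t => Φ.flow t z) ∩ Icc t₁ t₂, H (Φ.flow r z) := by
    filter_upwards [hae] with z hz
    have hw : Φ.flow t₁ z ∈ Φ.good := Φ.mapsTo_good t₁ hz
    calc ENNReal.ofReal (F (Φ.flow t₁ z))
        ≤ ENNReal.ofReal (∑ᶠ r ∈ collisionTimes (Torus.geometry (Fin 3)) (hsDiameter σ N)
              (fun t => Φ.flow t (Φ.flow t₁ z)) ∩ Icc 0 (t₂ - t₁), ∑ i, ∑ k,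
            (if i ≠ k ∧ ‖(Torus.geometry (Fin 3)).sepVec (Φ.flow r (Φ.flow t₁ z) i).1 (Φ.flow r (Φ.flow t₁ z) k).1‖ =
                hsDiameter σ N then M (Φ.flow r (Φ.flow t₁ z)) i k else 0)) :=
          ENNReal.ofReal_le_ofReal (collisionalTransferFunctional_le_finsum_ite Φ hε hM hgM hw _)
      _ = ∑ᶠ r ∈ collisionTimes (Torus.geometry (Fin 3)) (hsDiameter σ N) (fun t => Φ.flow t (Φ.flow t₁ z)) ∩
            Icc 0 (t₂ - t₁), H (Φ.flow r (Φ.flow t₁ z)) := mmr_ofReal_finsum_ite_eq Φ hw _ hM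
      _ = ∑ᶠ r ∈ collisionTimes (Torus.geometry (Fin 3)) (hsDiameter σ N) (fun t => Φ.flow t z) ∩
            Icc t₁ (t₁ + (t₂ - t₁)), H (Φ.flow r z) := (finsum_collisionTimes_shift Φ hz t₁ (t₂ - t₁) H).symm
      _ = _ := by rw [add_sub_cancel]
  have hkey : ENNReal.ofReal (hsDiameter σ N / ((N + 1 : ℕ) : ℝ)) * ∫⁻ z, ENNReal.ofReal (F (Φ.flow t₁ z)) ∂P ≤
      ENNReal.ofReal C := (mul_le_mul' le_rfl (lintegral_mono_ae hpath)).trans hflux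
  have h := ENNReal.toReal_le_of_le_ofReal hC hkey
  rw [ENNReal.toReal_mul, ENNReal.toReal_ofReal (div_nonneg hεpos.le (Nat.cast_nonneg _)), div_eq_mul_inv] at h
  rw [integral_eq_lintegral_of_nonneg_ae (Eventually.of_forall fun z => hF0 _) hI.aestronglyMeasurable]
  exact h

/-- **The energy case of the reduction, at every `N`**: for continuous `a₀, θ₀ > 0`, `u₀`, `0 < σ ≤ 1/2`, a flow
`Φ`, `0 ≤ t₁ ≤ t₂` and `C ≥ 0`, IF
`(ε_N/(N+1)) E_{LG}[Σᶠ_{r ∈ [t₁,t₂]} Σᵢ Σ_k 𝟙{contact} ‖vᵢ − v_k‖ (‖vᵢ‖ + ‖v_k‖)(Φ_r z)] ≤ C` under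
`LG = localGibbsLaw σ a₀ u₀ θ₀ N Φ`, THEN `(ε_N/(N+1)) E_{LG}[𝒮ᴱ(Φ_{t₁} z; (0, t₂ − t₁])] ≤ C`
(integrability is unconditional, `integrable_absEnergyJumpFunctional_flow`; `N = 0` is trivial). [folklore] -/
theorem integral_absEnergyJumpFunctional_flow_le_of_energyFluxBound (ha : Continuous a₀) (hθ : Continuous θ₀)
    (hu : Continuous u₀) (ha0 : ∀ x, 0 < a₀ x) (hθ0 : ∀ x, 0 < θ₀ x) {σ : ℝ} (hσ : 0 < σ) (hσ2 : σ ≤ 1 / 2) {N : ℕ}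
    (Φ : HardSphereFlow (Torus.geometry (Fin 3)) (hsDiameter σ N) (N + 1)) {t₁ t₂ : ℝ} (h₁ : 0 ≤ t₁) (h₁₂ : t₁ ≤ t₂)
    {C : ℝ} (hC : 0 ≤ C)
    (hflux : ENNReal.ofReal (hsDiameter σ N / ((N + 1 : ℕ) : ℝ)) *
      ∫⁻ z, (∑ᶠ r ∈ collisionTimes (Torus.geometry (Fin 3)) (hsDiameter σ N) (fun t => Φ.flow t z) ∩ Icc t₁ t₂,
        ∑ i, ∑ k, (if i ≠ k ∧ ‖(Torus.geometry (Fin 3)).sepVec (Φ.flow r z i).1 (Φ.flow r z k).1‖ = hsDiameter σ N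
          then ENNReal.ofReal (‖(Φ.flow r z i).2 - (Φ.flow r z k).2‖ * (‖(Φ.flow r z i).2‖ + ‖(Φ.flow r z k).2‖)) else 0))
        ∂(localGibbsLaw σ a₀ u₀ θ₀ N Φ) ≤ ENNReal.ofReal C) :
    hsDiameter σ N * ((N + 1 : ℕ) : ℝ)⁻¹ * ∫ z, Φ.collisionalTransferFunctional
        (fun (i _j : Fin (N + 1)) (pre post : Config (N + 1) (Fin 3) T3) => |‖(post i).2‖ ^ 2 - ‖(pre i).2‖ ^ 2| / 2)
        (Φ.flow t₁ z) (t₂ - t₁) ∂(localGibbsLaw σ a₀ u₀ θ₀ N Φ) ≤ C := by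
  rcases Nat.eq_zero_or_pos N with hN0 | hN
  · subst hN0
    have h0 : ∀ z, Φ.collisionalTransferFunctional (fun (i _j : Fin (0 + 1)) (pre post : Config (0 + 1) (Fin 3) T3) =>
        |‖(post i).2‖ ^ 2 - ‖(pre i).2‖ ^ 2| / 2) (Φ.flow t₁ z) (t₂ - t₁) = 0 := fun z =>
      collisionalTransferFunctional_eq_zero_of_le_one Φ le_rfl _ _ _
    simp only [h0, integral_zero, mul_zero]
    exact hC
  · have hPac : localGibbsLaw σ a₀ u₀ θ₀ N Φ ≪ liouville (Torus.geometry (Fin 3)) (N + 1) (hsDiameter σ N) := by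
      rw [localGibbsLaw_eq]; exact localGibbsMeasure_absolutelyContinuous σ _ _ _ N Φ
    exact integral_flow_le_of_windowFluxBound hσ hN hσ2 Φ (fun _ _ _ _ => by positivity)
      (M := fun w i k => ‖(w i).2 - (w k).2‖ * (‖(w i).2‖ + ‖(w k).2‖)) (fun _ _ _ => by positivity)
      (fun hγ t p hp => absEnergyJumpKernel_le_mark hγ t p hp) _ (hPac Φ.measure_compl_good)
      (integrable_absEnergyJumpFunctional_flow ha hθ hu ha0 hθ0 hσ hσ2 Φ h₁ h₁₂) hC hflux

/-! ## The window flux from a pair envelope; the stub from `LanfordEnvelopeR` -/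

open Summit.AtomisticToContinuum.HydrodynamicLimit.Theorems.CollisionActivityTailsAbnormalActivityStatics
  (windowEvent pairTubeSet measurableSet_pairTubeSet measurableSet_windowEvent mem_windowEvent_of_contact)
open Summit.AtomisticToContinuum.HydrodynamicLimit.Theorems.CollisionRate (lintegral_pairTubeSet_indicator_le)

/-- **Mean window collision flux of a velocity mark from a PAIR ENVELOPE at the times of the window** (mean form,
general window, of `CollisionRate.stub_collisionMarkFluxLG_of_envelope`). For a flow `Φ` of `N + 1` spheres of diameter
`ε = ε_N`, a law `P` carried by the good set whose time-`r` pair marginals, `r ∈ [t₁, t₁ + τ]`, are dominated by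
`C · (Haar ⊗ γ)^{⊗2}` (`henv`), and a measurable real mark `b` of the two velocities (read through `ofReal`):
`E_P[Σᶠ_{collision times s ∈ [t₁, t₁+τ]} Σᵢ Σⱼ 𝟙{contact} b(vᵢ(s), vⱼ(s))] ≤ 4 C τ (N+1)² ε² · ∫ ‖w − v‖ b(v, w) dγ(v) dγ(w)` — the
non-stationary one-window / Campbell inequality `lintegral_le_liminf_mul_of_le_collisionSum` (window events cut from the
swept tubes `exists_sweptTube` of mesh `τ/M`, marks constant along free flight), the one-window statics
`lintegral_pairTubeSet_indicator_le` under the envelope, and `M · (τ/M) = τ`. [cite: CIP1994, App. 4.A] -/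
theorem lintegral_windowCollisionSum_le_of_pairEnvelope {σ : ℝ} (hσ : 0 < σ) {N : ℕ}
    (Φ : HardSphereFlow (Torus.geometry (Fin 3)) (hsDiameter σ N) (N + 1)) (P : Measure (Config (N + 1) (Fin 3) T3))
    (hP : P Φ.goodᶜ = 0) (t₁ : ℝ) {τ : ℝ} (hτ : 0 < τ) {C : ℝ} (hC : 0 ≤ C) (γ : Measure V3) [SFinite γ]
    (henv : ∀ r ∈ Icc t₁ (t₁ + τ), ∀ i j : Fin (N + 1), i ≠ j → ∀ f : (T3 × V3) × (T3 × V3) → ℝ≥0∞, Measurable f →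
      ∫⁻ z, f (Φ.flow r z i, Φ.flow r z j) ∂P ≤
        ENNReal.ofReal C * ∫⁻ q, f q ∂(((volume : Measure T3).prod γ).prod ((volume : Measure T3).prod γ)))
    {b : V3 × V3 → ℝ} (hbm : Measurable b) :
    ∫⁻ z, (∑ᶠ s ∈ collisionTimes (Torus.geometry (Fin 3)) (hsDiameter σ N) (fun t => Φ.flow t z) ∩ Icc t₁ (t₁ + τ),
        ∑ i, ∑ j, (if i ≠ j ∧ ‖(Torus.geometry (Fin 3)).sepVec (Φ.flow s z i).1 (Φ.flow s z j).1‖ = hsDiameter σ N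
          then ENNReal.ofReal (b ((Φ.flow s z i).2, (Φ.flow s z j).2)) else 0)) ∂P ≤
      ENNReal.ofReal (4 * C * τ * ((N + 1 : ℕ) : ℝ) ^ 2 * hsDiameter σ N ^ 2) *
        ∫⁻ p, ENNReal.ofReal ‖p.2 - p.1‖ * ENNReal.ofReal (b p) ∂(γ.prod γ) := by
  -- adapted from `CollisionRate.stub_collisionMarkFluxLG_of_envelope` (window `[t₁, t₁ + τ]`, mean instead of Markov)
  have hε : 0 < hsDiameter σ N := hsDiameter_pos hσ N
  set A : V3 × V3 → ℝ≥0∞ := fun p => ENNReal.ofReal (b p) with hAdef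
  have hAm : Measurable A := hbm.ennreal_ofReal
  set I : ℝ≥0∞ := ∫⁻ p, ENNReal.ofReal ‖p.2 - p.1‖ * A p ∂(γ.prod γ) with hIdef
  set F : Config (N + 1) (Fin 3) T3 → Fin (N + 1) → Fin (N + 1) → ℝ≥0∞ := fun w i j => A ((w i).2, (w j).2) with hFdef
  have hFm : ∀ i j, Measurable fun w => F w i j :=
    fun i j => hAm.comp ((measurable_pi_apply i).snd.prodMk (measurable_pi_apply j).snd)
  have hFfree : ∀ (t : ℝ) (w : Config (N + 1) (Fin 3) T3) (i j : Fin (N + 1)),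
      F (freeFlight (Torus.geometry (Fin 3)) (-t) w) i j = F w i j := by
    intro t w i j
    simp only [hFdef, freeFlight_apply]
  -- the swept tubes of mesh `τ / M` and the window events cut from them
  have htube : ∀ M : ℕ, ∃ S : V3 → Set V3, MeasurableSet {q : V3 × V3 | q.1 ∈ S q.2} ∧
      (∀ v, volume (S v) ≤ ENNReal.ofReal (4 * hsDiameter σ N ^ 2 * (τ / M) * ‖v‖)) ∧
      ∀ (v r : V3) (s : ℝ), hsDiameter σ N ≤ ‖r‖ → s ∈ Icc 0 (τ / M) → ‖r + s • v‖ = hsDiameter σ N → r ∈ S v :=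
    fun M => exists_sweptTube hε (div_nonneg hτ.le (Nat.cast_nonneg M))
  choose S hSm hSvol hS using htube
  set E : ℕ → Fin (N + 1) → Fin (N + 1) → Set (Config (N + 1) (Fin 3) T3) := fun M k l => windowEvent (S M) k l with hE
  set n : ℝ≥0∞ := ((N + 1 : ℕ) : ℝ≥0∞) with hn
  set B : ℕ → ℝ≥0∞ := fun M => n * n * (ENNReal.ofReal C * (ENNReal.ofReal (4 * hsDiameter σ N ^ 2 * (τ / M)) * I)) with hB
  -- the one-window bound of ONE ordered pair under the law at a time `r` of the window: envelope + statics
  have hterm : ∀ (M : ℕ), ∀ r ∈ Icc t₁ (t₁ + τ), ∀ k l : Fin (N + 1), k ≠ l →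
      ∫⁻ x, (E M k l).indicator (fun x => F x k l) x ∂(P.map (Φ.flow r)) ≤
        ENNReal.ofReal C * (ENNReal.ofReal (4 * hsDiameter σ N ^ 2 * (τ / M)) * I) := by
    intro M r hr k l hkl
    set f : (T3 × V3) × (T3 × V3) → ℝ≥0∞ := fun q =>
      (pairTubeSet (S M)).indicator (fun q' => A q'.2) (q.2.1 - q.1.1, q.2.2, q.1.2) with hf
    have hfm : Measurable f :=
      ((hAm.comp measurable_snd).indicator (measurableSet_pairTubeSet (hSm M))).comp
        ((measurable_snd.fst.sub measurable_fst.fst).prodMk (measurable_snd.snd.prodMk measurable_fst.snd))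
    have hpt : ∀ w : Config (N + 1) (Fin 3) T3, (E M k l).indicator (fun x => F x k l) w = f (w l, w k) := by
      intro w
      by_cases hw : w ∈ E M k l
      · have hw' : ((w k).1 - (w l).1, (w k).2, (w l).2) ∈ pairTubeSet (S M) := hw
        rw [indicator_of_mem hw, hf]
        exact (indicator_of_mem hw' fun q' : T3 × V3 × V3 => A q'.2).symm
      · have hw' : ((w k).1 - (w l).1, (w k).2, (w l).2) ∉ pairTubeSet (S M) := hw
        rw [indicator_of_notMem hw, hf]
        exact (indicator_of_notMem hw' fun q' : T3 × V3 × V3 => A q'.2).symm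
    calc ∫⁻ x, (E M k l).indicator (fun x => F x k l) x ∂(P.map (Φ.flow r))
        ≤ ∫⁻ z, (E M k l).indicator (fun x => F x k l) (Φ.flow r z) ∂P := lintegral_map_le _ _
      _ = ∫⁻ z, f (Φ.flow r z l, Φ.flow r z k) ∂P := lintegral_congr fun z => hpt _
      _ ≤ ENNReal.ofReal C * ∫⁻ q, f q ∂(((volume : Measure T3).prod γ).prod ((volume : Measure T3).prod γ)) :=
          henv r hr l k hkl.symm f hfm
      _ ≤ ENNReal.ofReal C * (ENNReal.ofReal (4 * hsDiameter σ N ^ 2 * (τ / M)) * I) := by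
          gcongr
          exact lintegral_pairTubeSet_indicator_le γ (hSm M) (hSvol M) hAm
  -- the one-window bound under the laws at ALL times of the window
  have hBle : ∀ (M : ℕ), ∀ r ∈ Icc t₁ (t₁ + τ),
      ∫⁻ x, ∑ k : Fin (N + 1), ∑ l : Fin (N + 1),
        (if k ≠ l then (E M k l).indicator (fun x => F x k l) x else 0) ∂(P.map (Φ.flow r)) ≤ B M := by
    intro M r hr
    have hterm' : ∀ k l : Fin (N + 1), ∫⁻ x, (if k ≠ l then (E M k l).indicator (fun x => F x k l) x else 0)
        ∂(P.map (Φ.flow r)) ≤ ENNReal.ofReal C * (ENNReal.ofReal (4 * hsDiameter σ N ^ 2 * (τ / M)) * I) := by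
      intro k l
      by_cases hkl : k ≠ l
      · simp only [if_pos hkl]; exact hterm M r hr k l hkl
      · simp only [if_neg hkl, lintegral_zero, zero_le]
    have hmeas : ∀ k l : Fin (N + 1), Measurable fun x : Config (N + 1) (Fin 3) T3 =>
        (if k ≠ l then (E M k l).indicator (fun x => F x k l) x else 0) := by
      intro k l
      by_cases hkl : k ≠ l
      · simp only [if_pos hkl]; exact (hFm k l).indicator (measurableSet_windowEvent (hSm M) k l)
      · simp only [if_neg hkl]; exact measurable_const
    calc _ = ∑ k : Fin (N + 1), ∑ l : Fin (N + 1), ∫⁻ x, (if k ≠ l then (E M k l).indicator (fun x => F x k l) x else 0)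
          ∂(P.map (Φ.flow r)) := by
          rw [lintegral_finsetSum _ fun k _ => Finset.measurable_sum _ fun l _ => hmeas k l]
          exact Finset.sum_congr rfl fun k _ => lintegral_finsetSum _ fun l _ => hmeas k l
      _ ≤ ∑ _k : Fin (N + 1), ∑ _l : Fin (N + 1), ENNReal.ofReal C * (ENNReal.ofReal (4 * hsDiameter σ N ^ 2 * (τ / M)) * I) :=
          Finset.sum_le_sum fun k _ => Finset.sum_le_sum fun l _ => hterm' k l
      _ = B M := by
          simp only [Finset.sum_const, Finset.card_univ, Fintype.card_fin, nsmul_eq_mul, hB, hn]; ring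
  -- the window inequality for the collision sum itself (dominated by itself on the good set)
  have hmain := lintegral_le_liminf_mul_of_le_collisionSum Φ P hP hτ t₁ F E
    (fun M k l => measurableSet_windowEvent (hSm M) k l)
    (fun M k l hkl x hx t' ht' hc => mem_windowEvent_of_contact (hS M) hkl hx ht' hc)
    (fun _ => F) (fun _ k l => hFm k l) (fun M k l _ x _ t' _ _ => (hFfree t' x k l).le) B hBle _ (fun z _ => le_rfl)
  -- `liminf_M M · B M ≤ (N+1)² C · 4 ε² τ · I`
  set L : ℝ≥0∞ := n * n * (ENNReal.ofReal C * (ENNReal.ofReal (4 * hsDiameter σ N ^ 2 * τ) * I)) with hL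
  have hMB : ∀ M : ℕ, 1 ≤ M → (M : ℝ≥0∞) * B M = L := by
    intro M hM
    have hM0 : (0 : ℝ) < M := by exact_mod_cast hM
    have hkey : (M : ℝ≥0∞) * ENNReal.ofReal (4 * hsDiameter σ N ^ 2 * (τ / M)) = ENNReal.ofReal (4 * hsDiameter σ N ^ 2 * τ) := by
      rw [← ENNReal.ofReal_natCast, ← ENNReal.ofReal_mul (Nat.cast_nonneg M)]
      congr 1; field_simp
    rw [hB, hL, ← hkey]; ring
  have hlim : liminf (fun M : ℕ => (M : ℝ≥0∞) * B M) atTop ≤ L :=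
    liminf_le_of_frequently_le' (((eventually_ge_atTop 1).mono fun M hM => (hMB M hM).le).frequently)
  have hconst : L = ENNReal.ofReal (4 * C * τ * ((N + 1 : ℕ) : ℝ) ^ 2 * hsDiameter σ N ^ 2) * I := by
    have hn' : n = ENNReal.ofReal ((N + 1 : ℕ) : ℝ) := by rw [hn, ENNReal.ofReal_natCast]
    have hm0 : (0 : ℝ) ≤ ((N + 1 : ℕ) : ℝ) := Nat.cast_nonneg _
    have hreal : ((N + 1 : ℕ) : ℝ) * ((N + 1 : ℕ) : ℝ) * C * (4 * hsDiameter σ N ^ 2 * τ) = 4 * C * τ * ((N + 1 : ℕ) : ℝ) ^ 2 * hsDiameter σ N ^ 2 := by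
      ring
    calc L = n * n * ENNReal.ofReal C * ENNReal.ofReal (4 * hsDiameter σ N ^ 2 * τ) * I := by rw [hL]; ring
      _ = ENNReal.ofReal (((N + 1 : ℕ) : ℝ) * ((N + 1 : ℕ) : ℝ) * C * (4 * hsDiameter σ N ^ 2 * τ)) * I := by
          rw [hn', ← ENNReal.ofReal_mul hm0, ← ENNReal.ofReal_mul (mul_nonneg hm0 hm0),
            ← ENNReal.ofReal_mul (mul_nonneg (mul_nonneg hm0 hm0) hC)]
      _ = _ := by rw [hreal]
  exact hmain.trans (hlim.trans_eq hconst)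

/-- **The registered stub FOLLOWS from the marginal envelope (A) of the evolved local Gibbs law** — hypothesis (A) of crux
`InformationPercolationEngine.CollisionRate` VERBATIM (pair and triple conjuncts; only the pair one is used): with the Gaussian
flux integral of the energy mark `≤ 8 (1 + 8(‖u‖⁴ + 15 θ²))` (`mmr_lintegral_energyMark_prod_gaussMeasure_le`) and
`(N+1) ε_N³ = σ³`, `lintegral_windowCollisionSum_le_of_pairEnvelope` gives the window flux bound
`(ε_N/(N+1)) E[…] ≤ 4 C (t₂ − t₁) σ³ · 8 M₃` for `N ≥ N₀`, and `integral_absEnergyJumpFunctional_flow_le_of_energyFluxBound` the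
stub (`σ₀ := min σ₀(A) (1/2)`; the window `t₁ = t₂` is trivial). [folklore] -/
theorem stub_of_marginalEnvelope
    (hA : ∀ (a₀ θ₀ : T3 → ℝ) (u₀ : T3 → V3), Continuous a₀ → Continuous θ₀ → Continuous u₀ →
      (∀ x, 0 < a₀ x) → (∀ x, 0 < θ₀ x) → ∃ σ₀ : ℝ, 0 < σ₀ ∧ ∀ σ : ℝ, 0 < σ → σ < σ₀ →
      ∀ Φ : (N : ℕ) → HardSphereFlow (Torus.geometry (Fin 3)) (hsDiameter σ N) (N + 1),
      ∀ τ : ℝ, 0 < τ → ∃ C : ℝ, 0 ≤ C ∧ ∃ u : V3, ∃ θ : ℝ, 0 < θ ∧ ∃ N₀ : ℕ, ∀ N : ℕ, N₀ ≤ N →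
      ∀ t ∈ Set.Icc (0 : ℝ) τ,
        (∀ i j : Fin (N + 1), i ≠ j → ∀ f : (T3 × V3) × (T3 × V3) → ℝ≥0∞, Measurable f →
          ∫⁻ z, f ((Φ N).flow t z i, (Φ N).flow t z j) ∂(localGibbsLaw σ a₀ u₀ θ₀ N (Φ N)) ≤
            ENNReal.ofReal C * ∫⁻ q, f q ∂(((volume : Measure T3).prod (gaussMeasure u θ)).prod
              ((volume : Measure T3).prod (gaussMeasure u θ)))) ∧
        (∀ i j k : Fin (N + 1), i ≠ j → i ≠ k → j ≠ k → ∀ f : (T3 × V3) × (T3 × V3) × (T3 × V3) → ℝ≥0∞, Measurable f →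
          ∫⁻ z, f ((Φ N).flow t z i, (Φ N).flow t z j, (Φ N).flow t z k) ∂(localGibbsLaw σ a₀ u₀ θ₀ N (Φ N)) ≤
            ENNReal.ofReal C * ∫⁻ q, f q ∂(((volume : Measure T3).prod (gaussMeasure u θ)).prod
              (((volume : Measure T3).prod (gaussMeasure u θ)).prod ((volume : Measure T3).prod (gaussMeasure u θ)))))) :
    ∀ (a₀ θ₀ : Literature.MathematicalPhysics.KineticTheory.T3 → ℝ) (u₀ : Literature.MathematicalPhysics.KineticTheory.T3 → Literature.MathematicalPhysics.KineticTheory.V3), Continuous a₀ → Continuous θ₀ → Continuous u₀ → (∀ x, 0 < a₀ x) → (∀ x, 0 < θ₀ x) → ∃ σ₀ : ℝ, 0 < σ₀ ∧ ∀ σ : ℝ, 0 < σ → σ < σ₀ → ∀ Φ : (N : ℕ) → Literature.Analysis.FluidPDE.HardSphereFlow (Literature.Analysis.FluidPDE.Torus.geometry (Fin 3)) (Literature.MathematicalPhysics.KineticTheory.hsDiameter σ N) (N + 1), ∀ t₁ t₂ : ℝ, 0 ≤ t₁ → t₁ ≤ t₂ → ∃ C : ℝ, ∀ᶠ N in Filter.atTop,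 ∀ Q : Literature.Analysis.FluidPDE.Config (N + 1) (Fin 3) Literature.MathematicalPhysics.KineticTheory.T3 → ℝ, Q = (fun z => Literature.MathematicalPhysics.KineticTheory.hsDiameter σ N * ((N + 1 : ℕ) : ℝ)⁻¹ * (Φ N).collisionalTransferFunctional (fun (i _j : Fin (N + 1)) (pre post : Literature.Analysis.FluidPDE.Config (N + 1) (Fin 3) Literature.MathematicalPhysics.KineticTheory.T3) => |‖(post i).2‖ ^ 2 - ‖(pre i).2‖ ^ 2| / 2) ((Φ N).flow t₁ z) (t₂ - t₁)) → MeasureTheory.Integrable Q (Literature.MathematicalPhysics.KineticTheory.localGibbsLaw σ a₀ u₀ θ₀ N (Φ N)) ∧ ∫ z, Q z ∂Literature.MathematicalPhysics.KineticTheory.localGibbsLaw σ a₀ u₀ θ₀ N (Φ N) ≤ C := by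
  intro a₀ θ₀ u₀ ha hθ hu ha0 hθ0
  obtain ⟨σ₀, hσ₀, hA'⟩ := hA a₀ θ₀ u₀ ha hθ hu ha0 hθ0
  refine ⟨min σ₀ (1 / 2), lt_min hσ₀ (by norm_num), fun σ hσ hσlt Φ t₁ t₂ h₁ h₁₂ => ?_⟩
  have hσ2 : σ ≤ 1 / 2 := (hσlt.trans_le (min_le_right _ _)).le
  rcases eq_or_lt_of_le h₁₂ with heq | hlt
  · subst heq
    refine ⟨0, Eventually.of_forall fun N Q hQ => ?_⟩
    subst hQ
    simp only [sub_self, HardSphereFlow.collisionalTransferFunctional_zero, mul_zero, integral_zero]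
    exact ⟨integrable_zero _ _ _, le_rfl⟩
  obtain ⟨C, hC, u, θ, hθpos, N₀, hN⟩ := hA' σ hσ (hσlt.trans_le (min_le_left _ _)) Φ t₂ (h₁.trans_lt hlt)
  set K : ℝ := 4 * C * (t₂ - t₁) * σ ^ 3 * (8 * (1 + 8 * (‖u‖ ^ 4 + 15 * θ ^ 2))) with hKdef
  have hK0 : 0 ≤ K := by have := sub_pos.2 hlt; positivity
  refine ⟨K, ?_⟩
  filter_upwards [eventually_ge_atTop N₀] with N hNN Q hQ
  subst hQ
  refine ⟨(integrable_absEnergyJumpFunctional_flow ha hθ hu ha0 hθ0 hσ hσ2 (Φ N) h₁ h₁₂).const_mul _, ?_⟩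
  set P := localGibbsLaw σ a₀ u₀ θ₀ N (Φ N) with hPdef
  have hPgood : P (Φ N).goodᶜ = 0 := by
    rw [hPdef, localGibbsLaw_eq]; exact localGibbsMeasure_absolutelyContinuous σ _ _ _ N (Φ N) (Φ N).measure_compl_good
  have henv : ∀ r ∈ Icc t₁ (t₁ + (t₂ - t₁)), ∀ i j : Fin (N + 1), i ≠ j → ∀ f : (T3 × V3) × (T3 × V3) → ℝ≥0∞, Measurable f →
      ∫⁻ z, f ((Φ N).flow r z i, (Φ N).flow r z j) ∂P ≤ ENNReal.ofReal C * ∫⁻ q, f q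
        ∂(((volume : Measure T3).prod (gaussMeasure u θ)).prod ((volume : Measure T3).prod (gaussMeasure u θ))) :=
    fun r hr i j hij f hf => (hN N hNN r ⟨h₁.trans hr.1, by linarith [hr.2]⟩).1 i j hij f hf
  have hw := lintegral_windowCollisionSum_le_of_pairEnvelope hσ (Φ N) P hPgood t₁ (sub_pos.2 hlt) hC (gaussMeasure u θ) henv
    (b := fun p => ‖p.1 - p.2‖ * (‖p.1‖ + ‖p.2‖)) (by fun_prop)
  rw [add_sub_cancel] at hw
  have hflux : ENNReal.ofReal (hsDiameter σ N / ((N + 1 : ℕ) : ℝ)) *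
      ∫⁻ z, (∑ᶠ r ∈ collisionTimes (Torus.geometry (Fin 3)) (hsDiameter σ N) (fun t => (Φ N).flow t z) ∩ Icc t₁ t₂,
        ∑ i, ∑ k, (if i ≠ k ∧ ‖(Torus.geometry (Fin 3)).sepVec ((Φ N).flow r z i).1 ((Φ N).flow r z k).1‖ = hsDiameter σ N
          then ENNReal.ofReal (‖((Φ N).flow r z i).2 - ((Φ N).flow r z k).2‖ * (‖((Φ N).flow r z i).2‖ + ‖((Φ N).flow r z k).2‖))
          else 0)) ∂P ≤ ENNReal.ofReal K := by
    have hε0 : 0 ≤ hsDiameter σ N / ((N + 1 : ℕ) : ℝ) := div_nonneg (hsDiameter_pos hσ N).le (Nat.cast_nonneg _)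
    have h4 : 0 ≤ 4 * C * (t₂ - t₁) * ((N + 1 : ℕ) : ℝ) ^ 2 * hsDiameter σ N ^ 2 := by have := sub_pos.2 hlt; positivity
    have hn : ((N + 1 : ℕ) : ℝ) ≠ 0 := by positivity
    have hreal : hsDiameter σ N / ((N + 1 : ℕ) : ℝ) * (4 * C * (t₂ - t₁) * ((N + 1 : ℕ) : ℝ) ^ 2 * hsDiameter σ N ^ 2 *
        (8 * (1 + 8 * (‖u‖ ^ 4 + 15 * θ ^ 2)))) = K := by
      calc _ = (((N + 1 : ℕ) : ℝ))⁻¹ * ((N + 1 : ℕ) : ℝ) * (4 * C * (t₂ - t₁) * (((N + 1 : ℕ) : ℝ) * hsDiameter σ N ^ 3) *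
            (8 * (1 + 8 * (‖u‖ ^ 4 + 15 * θ ^ 2)))) := by rw [div_eq_mul_inv]; ring
        _ = K := by rw [inv_mul_cancel₀ hn, one_mul, succ_mul_hsDiameter_pow_three, hKdef]
    refine (mul_le_mul' le_rfl (hw.trans (mul_le_mul' le_rfl (mmr_lintegral_energyMark_prod_gaussMeasure_le u hθpos)))).trans
      (le_of_eq ?_)
    rw [← ENNReal.ofReal_mul h4, ← ENNReal.ofReal_mul hε0, hreal]
  have h := integral_absEnergyJumpFunctional_flow_le_of_energyFluxBound ha hθ hu ha0 hθ0 hσ hσ2 (Φ N) h₁ h₁₂ hK0 hflux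
  rwa [← integral_const_mul] at h

end CollisionEnergyExchangeMeanBound

open CollisionEnergyExchangeMeanBound in
/-- **The registered stub `stub_collisionEnergyExchangeMeanBound` FOLLOWS from the crux item
`Theses.BGEndpointRigidity.LanfordEnvelopeR`** (stmt-AtomisticToContinuum-13677, the Lanford/BGSR Gaussian envelope of all
marginals of the evolved local Gibbs law, open at positive times at fixed reduced density): `LanfordEnvelopeR` ⟹ marginal
envelope (A) (`CollisionRate.stub_marginalEnvelopeLG_of_lanfordEnvelopeR`) ⟹ the stub (`stub_of_marginalEnvelope`). [folklore] -/
theorem stub_collisionEnergyExchangeMeanBound_of_lanfordEnvelopeR : Summit.AtomisticToContinuum.HydrodynamicLimit.Theses.BGEndpointRigidity.LanfordEnvelopeR → ∀ (a₀ θ₀ : Literature.MathematicalPhysics.KineticTheory.T3 → ℝ) (u₀ : Literature.MathematicalPhysics.KineticTheory.T3 → Literature.MathematicalPhysics.KineticTheory.V3), Continuous a₀ → Continuous θ₀ → Continuous u₀ → (∀ x, 0 < a₀ x) → (∀ x, 0 < θ₀ x) → ∃ σ₀ : ℝ, 0 < σ₀ ∧ ∀ σ : ℝ, 0 < σ → σ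 < σ₀ → ∀ Φ : (N : ℕ) → Literature.Analysis.FluidPDE.HardSphereFlow (Literature.Analysis.FluidPDE.Torus.geometry (Fin 3)) (Literature.MathematicalPhysics.KineticTheory.hsDiameter σ N) (N + 1), ∀ t₁ t₂ : ℝ, 0 ≤ t₁ → t₁ ≤ t₂ → ∃ C : ℝ, ∀ᶠ N in Filter.atTop, ∀ Q : Literature.Analysis.FluidPDE.Config (N + 1) (Fin 3) Literature.MathematicalPhysics.KineticTheory.T3 → ℝ, Q = (fun z => Literature.MathematicalPhysics.KineticTheory.hsDiameter σ N * ((N + 1 : ℕ) : ℝ)⁻¹ * (Φ N).collisionalTransferFunctional (fun (i _j : Fin (N + 1)) (pre post : Literature.Analysis.FluidPDE.Config (N + 1) (Fin 3) Literature.MathematicalPhysics.KineticTheory.T3) => |‖(post i).2‖ ^ 2 - ‖(pre i).2‖ ^ 2| / 2) ((Φ N).flow t₁ z) (t₂ - t₁)) → MeasureTheory.Integrable Q (Literature.MathematicalPhysics.KineticTheory.localGibbsLaw σ a₀ u₀ θ₀ N (Φ N)) ∧ ∫ z, Q z ∂Literature.MathematicalPhysics.KineticTheory.localGibbsLaw σ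 a₀ u₀ θ₀ N (Φ N) ≤ C :=
  fun hL => stub_of_marginalEnvelope (CollisionRate.stub_marginalEnvelopeLG_of_lanfordEnvelopeR hL)

end Summit.AtomisticToContinuum.HydrodynamicLimit.Theorems

end
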